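import Summits.CriticalPhenomena.PercolationContinuityZ3.Theorems.Transplant.HeisenbergZPlanarSkeleton
import Summits.CriticalPhenomena.PercolationContinuityZ3.Theorems.Transplant.TubeBoundaryReach
import Summits.CriticalPhenomena.PercolationContinuityZ3.Theorems.Transplant.SkeletonDropNode
import HarnessLib

/-!
# Free same-`p` side-steering inside every cylinder of `H₃(ℤ) × ℤ` (lane lemma (F2) for rung R3a)

builds on p205010 (kernel theorem, internal audit signed; external expert review pending) — nothing in this file uses p205010.
Lane `prim-bschramm`, seat `prim-bschramm-p4` (gen 2; P4-GENERAL.md §10.2), helper file (`--supports stmt-CriticalPhenomena-4575`).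

For the cylinders `hzCyl ℓ = {|a| ≤ ℓ, |b| ≤ ℓ}` of `Cay(H₃(ℤ) × ℤ)` (`HeisenbergZPlanarSkeleton.lean`), `ℓ ≥ 1`:
* the induced cylinder graph is locally finite, CONNECTED (`hzCylGraph_connected`: commutator loops inside `{0,1}²` adjust `c`),
  carries the central shifts `(a,b,c,t) ↦ (a,b,c+c₀,t+t₀)` as automorphisms (`hzCylShift`, restriction of `hzLeftIso`), hence is
  quasi-transitive (`hzCylGraph_quasiTransitive`, `(2ℓ+1)²` orbit representatives) and of polynomial growth, so AMENABLE
  (`hzCylGraph_amenable`) — and the infinite cluster INSIDE the cylinder is a.s. unique at every `p` (tree Burton–Keane);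
* the shifts move finite sets off themselves and preserve the cylinder boundary `∂ = {|a| = ℓ or |b| = ℓ …}` (`tubeBoundary`);
* **`hz_theta_le_prob_reach_cylBoundary`**: for every `p > 0`, `ℓ ≥ 1` and `x ∈ hzCyl ℓ`,
  `θ_{H₃×ℤ}(x, p) ≤ P_p(x is joined to ∂(hzCyl ℓ) by an open path INSIDE hzCyl ℓ)` — by `theta_le_prob_reach_boundary_within`
  ((F1), `TubeBoundaryReach.lean`).
So at the SAME density (in particular at `p_c`), steering toward the planar boundary of any cylinder is free on this rung; the
residue `HeisenbergZCylSubcritical` ((Φ2′), thick-fibre subcriticality) is about how far along the fibre `⟨C,T⟩` such connections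
travel, which this lemma does not control (P4-GENERAL §10.1).  Last section: the rung's conditional closure from the DROP node of
design (D) (`SkeletonDropNode.lean`): `heisenbergZCriticalContinuity_of_dropNode_of_cylSubcritical`.
[cite: LyonsPeres2016, Thm. 7.5 and Thm. 7.6] [cite: BurtonKeane1989, Thm. 2] [cite: KozmaNitzan2024, §4 Lemma 9 (p. 16) — the ℤ^d model of steering]
-/

noncomputable section

open MeasureTheory Filter

namespace Summit.CriticalPhenomena.PercolationContinuityZ3.Theorems.Transplant

open Literature.Probability.Percolation Literature.Probability.LatticeModels SimpleGraph
open Literature.Barriers.CriticalPhenomena (IsQuasiTransitive IsGraphAmenable HasExponentialGrowth graphBall ballVolume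
  graphBall_finite hasExponentialGrowth_of_not_isGraphAmenable eventually_pow_lt_const_pow
  BurtonKeane1989_atMostOneInfiniteCluster_holds)
open HeisenbergZ

/-! ## §1 The induced cylinder graph -/

/-- The cylinder graph `G[hzCyl ℓ]`. [folklore] -/
abbrev hzCylGraph (ℓ : ℕ) : SimpleGraph (hzCyl ℓ) := heisenbergZGraph.induce (hzCyl ℓ)

/-- Membership in the cylinder, unfolded. [folklore] -/
theorem mem_hzCyl_iff {ℓ : ℕ} {x : HZ} : x ∈ hzCyl ℓ ↔ |x 0| ≤ ℓ ∧ |x 1| ≤ ℓ := Iff.rfl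

/-- Induced subgraphs of `heisenbergZGraph` are locally finite. [folklore] -/
instance heisenbergZGraph_induce_locallyFinite (s : Set HZ) : (heisenbergZGraph.induce s).LocallyFinite := fun x =>
  ((((heisenbergZGraph).neighborSet x.1).toFinite.preimage Subtype.val_injective.injOn).subset
    fun y (hy : (heisenbergZGraph.induce s).Adj x y) => by simpa [SimpleGraph.mem_neighborSet] using hy).fintype

/-- A generator step that stays in the cylinder is an edge of the cylinder graph. [folklore] -/
theorem hzCyl_step {ℓ : ℕ} {u : HZ} (hu : u ∈ hzCyl ℓ) {s : HZ} (hs : s ∈ hzGens) (hv : hzMul u s ∈ hzCyl ℓ) :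
    (hzCylGraph ℓ).Reachable ⟨u, hu⟩ ⟨hzMul u s, hv⟩ := by
  refine SimpleGraph.Adj.reachable ?_
  rw [SimpleGraph.comap_adj, Function.Embedding.coe_subtype]
  exact adj_mul_gen u ((mem_hzGens_iff s).1 hs)

/-- Transport of reachability targets along an equality of vertices. [folklore] -/
theorem hzCyl_reach_of_eq {ℓ : ℕ} {x : hzCyl ℓ} {v v' : HZ} {hv : v ∈ hzCyl ℓ} (h : v = v')
    (hr : (hzCylGraph ℓ).Reachable x ⟨v, hv⟩) : (hzCylGraph ℓ).Reachable x ⟨v', h ▸ hv⟩ := by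
  subst h; exact hr

/-! ## §2 Connectivity of the cylinder (`ℓ ≥ 1`) -/

/-- Explicit cylinder membership of a coordinate vector. [folklore] -/
theorem hzCyl_vec_mem (ℓ : ℕ) (a b c t : ℤ) (ha : |a| ≤ ℓ) (hb : |b| ≤ ℓ) : (![a, b, c, t] : HZ) ∈ hzCyl ℓ := by
  simpa [mem_hzCyl_iff] using And.intro ha hb

/-- `|0| ≤ ℓ`. [folklore] -/
theorem hz_abs_zero_le (ℓ : ℕ) : |(0 : ℤ)| ≤ ℓ := by simp

section Connected

variable {ℓ : ℕ} (hℓ : 1 ≤ ℓ)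
include hℓ

/-- `|1| ≤ ℓ` when `1 ≤ ℓ`. [folklore] -/
theorem hz_abs_one_le : |(1 : ℤ)| ≤ ℓ := by rw [abs_one]; exact_mod_cast hℓ

/-- `c ↦ c + 1` by the commutator loop `A B A⁻¹ B⁻¹` inside `{0,1}²`. [folklore] -/
theorem hzCyl_reach_c_succ (c : ℤ) :
    (hzCylGraph ℓ).Reachable ⟨![0, 0, c, 0], hzCyl_vec_mem ℓ 0 0 c 0 (hz_abs_zero_le ℓ) (hz_abs_zero_le ℓ)⟩
      ⟨![0, 0, c + 1, 0], hzCyl_vec_mem ℓ 0 0 (c + 1) 0 (hz_abs_zero_le ℓ) (hz_abs_zero_le ℓ)⟩ := by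
  have m1 := hzCyl_vec_mem ℓ 1 0 c 0 (hz_abs_one_le hℓ) (hz_abs_zero_le ℓ)
  have m2 := hzCyl_vec_mem ℓ 1 1 (c + 1) 0 (hz_abs_one_le hℓ) (hz_abs_one_le hℓ)
  have m3 := hzCyl_vec_mem ℓ 0 1 (c + 1) 0 (hz_abs_zero_le ℓ) (hz_abs_one_le hℓ)
  have m4 := hzCyl_vec_mem ℓ 0 0 (c + 1) 0 (hz_abs_zero_le ℓ) (hz_abs_zero_le ℓ)
  have e1 : hzMul ![0, 0, c, 0] gA = ![1, 0, c, 0] := by ext i; fin_cases i <;> simp [hzMul, gA]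
  have e2 : hzMul ![1, 0, c, 0] gB = ![1, 1, c + 1, 0] := by ext i; fin_cases i <;> simp [hzMul, gB]
  have e3 : hzMul ![1, 1, c + 1, 0] gAinv = ![0, 1, c + 1, 0] := by ext i; fin_cases i <;> simp [hzMul, gAinv]
  have e4 : hzMul ![0, 1, c + 1, 0] gBinv = ![0, 0, c + 1, 0] := by ext i; fin_cases i <;> simp [hzMul, gBinv]
  have hA : gA ∈ hzGens := by simp [hzGens]
  have hB : gB ∈ hzGens := by simp [hzGens]
  have hAi : gAinv ∈ hzGens := by simp [hzGens]
  have hBi : gBinv ∈ hzGens := by simp [hzGens]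
  have r1 := hzCyl_reach_of_eq e1 (hzCyl_step (hzCyl_vec_mem ℓ 0 0 c 0 (hz_abs_zero_le ℓ) (hz_abs_zero_le ℓ)) hA (e1 ▸ m1))
  have r2 := hzCyl_reach_of_eq e2 (hzCyl_step m1 hB (e2 ▸ m2))
  have r3 := hzCyl_reach_of_eq e3 (hzCyl_step m2 hAi (e3 ▸ m3))
  have r4 := hzCyl_reach_of_eq e4 (hzCyl_step m3 hBi (e4 ▸ m4))
  exact ((r1.trans r2).trans r3).trans r4

/-- `c ↦ c − 1` by the loop `B A B⁻¹ A⁻¹` inside `{0,1}²`. [folklore] -/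
theorem hzCyl_reach_c_pred (c : ℤ) :
    (hzCylGraph ℓ).Reachable ⟨![0, 0, c, 0], hzCyl_vec_mem ℓ 0 0 c 0 (hz_abs_zero_le ℓ) (hz_abs_zero_le ℓ)⟩
      ⟨![0, 0, c - 1, 0], hzCyl_vec_mem ℓ 0 0 (c - 1) 0 (hz_abs_zero_le ℓ) (hz_abs_zero_le ℓ)⟩ := by
  have m1 := hzCyl_vec_mem ℓ 0 1 c 0 (hz_abs_zero_le ℓ) (hz_abs_one_le hℓ)
  have m2 := hzCyl_vec_mem ℓ 1 1 c 0 (hz_abs_one_le hℓ) (hz_abs_one_le hℓ)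
  have m3 := hzCyl_vec_mem ℓ 1 0 (c - 1) 0 (hz_abs_one_le hℓ) (hz_abs_zero_le ℓ)
  have m4 := hzCyl_vec_mem ℓ 0 0 (c - 1) 0 (hz_abs_zero_le ℓ) (hz_abs_zero_le ℓ)
  have e1 : hzMul ![0, 0, c, 0] gB = ![0, 1, c, 0] := by ext i; fin_cases i <;> simp [hzMul, gB]
  have e2 : hzMul ![0, 1, c, 0] gA = ![1, 1, c, 0] := by ext i; fin_cases i <;> simp [hzMul, gA]
  have e3 : hzMul ![1, 1, c, 0] gBinv = ![1, 0, c - 1, 0] := by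
    ext i; fin_cases i <;> simp [hzMul, gBinv]; ring
  have e4 : hzMul ![1, 0, c - 1, 0] gAinv = ![0, 0, c - 1, 0] := by ext i; fin_cases i <;> simp [hzMul, gAinv]
  have hA : gA ∈ hzGens := by simp [hzGens]
  have hB : gB ∈ hzGens := by simp [hzGens]
  have hAi : gAinv ∈ hzGens := by simp [hzGens]
  have hBi : gBinv ∈ hzGens := by simp [hzGens]
  have r1 := hzCyl_reach_of_eq e1 (hzCyl_step (hzCyl_vec_mem ℓ 0 0 c 0 (hz_abs_zero_le ℓ) (hz_abs_zero_le ℓ)) hB (e1 ▸ m1))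
  have r2 := hzCyl_reach_of_eq e2 (hzCyl_step m1 hA (e2 ▸ m2))
  have r3 := hzCyl_reach_of_eq e3 (hzCyl_step m2 hBi (e3 ▸ m3))
  have r4 := hzCyl_reach_of_eq e4 (hzCyl_step m3 hAi (e4 ▸ m4))
  exact ((r1.trans r2).trans r3).trans r4

/-- From `1` to `(0,0,c,0)` inside the cylinder. [folklore] -/
theorem hzCyl_reach_c (c : ℤ) :
    (hzCylGraph ℓ).Reachable ⟨0, zero_mem_hzCyl ℓ⟩ ⟨![0, 0, c, 0], hzCyl_vec_mem ℓ 0 0 c 0 (hz_abs_zero_le ℓ) (hz_abs_zero_le ℓ)⟩ := by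
  induction c using Int.induction_on with
  | zero =>
    have e : (0 : HZ) = ![0, 0, 0, 0] := by ext i; fin_cases i <;> rfl
    exact hzCyl_reach_of_eq e (Reachable.refl _)
  | succ n ih => exact ih.trans (hzCyl_reach_c_succ hℓ n)
  | pred n ih => exact ih.trans (hzCyl_reach_c_pred hℓ (-n))

omit hℓ in
/-- From `(0,0,c,0)` to `(0,0,c,t)` inside the cylinder (`T`-steps). [folklore] -/
theorem hzCyl_reach_t (c t : ℤ) :
    (hzCylGraph ℓ).Reachable ⟨![0, 0, c, 0], hzCyl_vec_mem ℓ 0 0 c 0 (hz_abs_zero_le ℓ) (hz_abs_zero_le ℓ)⟩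
      ⟨![0, 0, c, t], hzCyl_vec_mem ℓ 0 0 c t (hz_abs_zero_le ℓ) (hz_abs_zero_le ℓ)⟩ := by
  induction t using Int.induction_on with
  | zero => exact Reachable.refl _
  | succ n ih =>
    have e : hzMul ![0, 0, c, (n : ℤ)] gT = ![0, 0, c, (n : ℤ) + 1] := by ext i; fin_cases i <;> simp [hzMul, gT]
    exact ih.trans (hzCyl_reach_of_eq e (hzCyl_step _ (by simp [hzGens]) (e ▸ hzCyl_vec_mem ℓ 0 0 c _ (hz_abs_zero_le ℓ) (hz_abs_zero_le ℓ))))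
  | pred n ih =>
    have e : hzMul ![0, 0, c, -(n : ℤ)] gTinv = ![0, 0, c, -(n : ℤ) - 1] := by
      ext i; fin_cases i <;> simp [hzMul, gTinv]; ring
    exact ih.trans (hzCyl_reach_of_eq e (hzCyl_step _ (by simp [hzGens]) (e ▸ hzCyl_vec_mem ℓ 0 0 c _ (hz_abs_zero_le ℓ) (hz_abs_zero_le ℓ))))

/-- From `(0,0,c,t)` to `(a,0,c,t)` inside the cylinder, `|a| ≤ ℓ` (`A`-steps; `c` is unchanged since `b = 0`). [folklore] -/
theorem hzCyl_reach_a (c t : ℤ) : ∀ a : ℤ, (ha : |a| ≤ ℓ) →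
    (hzCylGraph ℓ).Reachable ⟨![0, 0, c, t], hzCyl_vec_mem ℓ 0 0 c t (hz_abs_zero_le ℓ) (hz_abs_zero_le ℓ)⟩
      ⟨![a, 0, c, t], hzCyl_vec_mem ℓ a 0 c t ha (hz_abs_zero_le ℓ)⟩ := by
  intro a
  induction a using Int.induction_on with
  | zero => intro _; exact Reachable.refl _
  | succ n ih =>
    intro ha
    have hn : |(n : ℤ)| ≤ ℓ := by
      rw [abs_le] at ha ⊢; constructor <;> linarith
    have e : hzMul ![(n : ℤ), 0, c, t] gA = ![(n : ℤ) + 1, 0, c, t] := by ext i; fin_cases i <;> simp [hzMul, gA]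
    exact (ih hn).trans (hzCyl_reach_of_eq e (hzCyl_step _ (by simp [hzGens]) (e ▸ hzCyl_vec_mem ℓ _ 0 c t ha (hz_abs_zero_le ℓ))))
  | pred n ih =>
    intro ha
    have hn : |(-(n : ℤ))| ≤ ℓ := by
      rw [abs_le] at ha ⊢; constructor <;> linarith
    have e : hzMul ![-(n : ℤ), 0, c, t] gAinv = ![-(n : ℤ) - 1, 0, c, t] := by
      ext i; fin_cases i <;> simp [hzMul, gAinv]; ring
    exact (ih hn).trans (hzCyl_reach_of_eq e (hzCyl_step _ (by simp [hzGens]) (e ▸ hzCyl_vec_mem ℓ _ 0 c t ha (hz_abs_zero_le ℓ))))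

/-- From `(a,0,c₀,t)` to `(a,b,c₀+ab,t)` inside the cylinder, `|b| ≤ ℓ` (`B`-steps shift `c` by `a`). [folklore] -/
theorem hzCyl_reach_b (a c₀ t : ℤ) (ha : |a| ≤ ℓ) : ∀ b : ℤ, (hb : |b| ≤ ℓ) →
    (hzCylGraph ℓ).Reachable ⟨![a, 0, c₀, t], hzCyl_vec_mem ℓ a 0 c₀ t ha (hz_abs_zero_le ℓ)⟩
      ⟨![a, b, c₀ + a * b, t], hzCyl_vec_mem ℓ a b (c₀ + a * b) t ha hb⟩ := by
  intro b
  induction b using Int.induction_on with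
  | zero =>
    intro _
    have e : (![a, 0, c₀, t] : HZ) = ![a, 0, c₀ + a * 0, t] := by ext i; fin_cases i <;> simp
    exact hzCyl_reach_of_eq e (Reachable.refl _)
  | succ n ih =>
    intro hb
    have hn : |(n : ℤ)| ≤ ℓ := by
      rw [abs_le] at hb ⊢; constructor <;> linarith
    have e : hzMul ![a, (n : ℤ), c₀ + a * n, t] gB = ![a, (n : ℤ) + 1, c₀ + a * (n + 1), t] := by
      ext i; fin_cases i <;> simp [hzMul, gB]; ring
    exact (ih hn).trans (hzCyl_reach_of_eq e (hzCyl_step _ (by simp [hzGens]) (e ▸ hzCyl_vec_mem ℓ a _ _ t ha hb)))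
  | pred n ih =>
    intro hb
    have hn : |(-(n : ℤ))| ≤ ℓ := by
      rw [abs_le] at hb ⊢; constructor <;> linarith
    have e : hzMul ![a, -(n : ℤ), c₀ + a * -(n : ℤ), t] gBinv = ![a, -(n : ℤ) - 1, c₀ + a * (-(n : ℤ) - 1), t] := by
      ext i; fin_cases i <;> simp [hzMul, gBinv] <;> ring
    exact (ih hn).trans (hzCyl_reach_of_eq e (hzCyl_step _ (by simp [hzGens]) (e ▸ hzCyl_vec_mem ℓ a _ _ t ha hb)))

/-- Every cylinder vertex is joined to `1` inside the cylinder. [folklore] -/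
theorem hzCyl_reach_all (x : hzCyl ℓ) : (hzCylGraph ℓ).Reachable ⟨0, zero_mem_hzCyl ℓ⟩ x := by
  obtain ⟨x, hx⟩ := x
  have ha : |x 0| ≤ ℓ := hx.1
  have hb : |x 1| ≤ ℓ := hx.2
  set c₀ : ℤ := x 2 - x 0 * x 1 with hc₀
  have e : (![x 0, x 1, c₀ + x 0 * x 1, x 3] : HZ) = x := by
    ext i; fin_cases i <;> simp [hc₀]
  exact hzCyl_reach_of_eq e ((((hzCyl_reach_c hℓ c₀).trans (hzCyl_reach_t c₀ (x 3))).trans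
    (hzCyl_reach_a hℓ c₀ (x 3) (x 0) ha)).trans (hzCyl_reach_b hℓ (x 0) c₀ (x 3) ha (x 1) hb))

/-- **The cylinder graph is connected** (`ℓ ≥ 1`). [folklore] -/
theorem hzCylGraph_connected : (hzCylGraph ℓ).Connected :=
  { preconnected := fun u v => ((hzCyl_reach_all hℓ u).symm).trans (hzCyl_reach_all hℓ v)
    nonempty := ⟨⟨0, zero_mem_hzCyl ℓ⟩⟩ }

end Connected

/-! ## §3 Central shifts as automorphisms of the cylinder; they move finite sets off themselves and preserve the boundary -/

/-- Left multiplication by the central `(0,0,c,t)` maps the cylinder bijectively onto itself. [folklore] -/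
theorem hzLeftIso_central_bijOn (ℓ : ℕ) (c t : ℤ) : Set.BijOn (hzLeftIso ![0, 0, c, t]) (hzCyl ℓ) (hzCyl ℓ) := by
  refine Set.BijOn.mk (fun x hx => ?_) ((hzMul_right_injective _).injOn) (fun y hy => ?_)
  · rw [hzLeftIso_apply]; exact (hzMul_central_mem_hzCyl c t).2 hx
  · refine ⟨hzMul ![0, 0, -c, -t] y, (hzMul_central_mem_hzCyl (-c) (-t)).2 hy, ?_⟩
    rw [hzLeftIso_apply, ← hzMul_assoc]
    have : hzMul ![0, 0, c, t] ![0, 0, -c, -t] = (0 : HZ) := by ext i; fin_cases i <;> simp [hzMul]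
    rw [this, zero_hzMul]

/-- **The central shift `(a,b,c',t') ↦ (a,b,c'+c,t'+t)` as an automorphism of the cylinder graph.** [folklore] -/
def hzCylShift (ℓ : ℕ) (c t : ℤ) : hzCylGraph ℓ ≃g hzCylGraph ℓ :=
  (hzLeftIso ![0, 0, c, t]).induce (hzLeftIso_central_bijOn ℓ c t)

/-- The shift acts by left multiplication on the underlying vertex. [folklore] -/
@[simp] theorem hzCylShift_apply_val (ℓ : ℕ) (c t : ℤ) (v : hzCyl ℓ) :
    ((hzCylShift ℓ c t v : hzCyl ℓ) : HZ) = hzMul ![0, 0, c, t] v := rfl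

/-- Coordinates of a central shift. [folklore] -/
theorem hzMul_central_apply (c t : ℤ) (x : HZ) :
    hzMul ![0, 0, c, t] x 0 = x 0 ∧ hzMul ![0, 0, c, t] x 1 = x 1 ∧ hzMul ![0, 0, c, t] x 2 = x 2 + c ∧
      hzMul ![0, 0, c, t] x 3 = x 3 + t := by
  refine ⟨by simp [hzMul], by simp [hzMul], by simp [hzMul]; ring, by simp [hzMul]; ring⟩

/-- The family of central shifts. [folklore] -/
def hzCylShifts (ℓ : ℕ) : Set (hzCylGraph ℓ ≃g hzCylGraph ℓ) := Set.range fun ct : ℤ × ℤ => hzCylShift ℓ ct.1 ct.2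

/-- **Central shifts move finite sets off themselves** (shift `t` beyond the finite set's `t`-range). [cite: LyonsPeres2016, Lemma 7.4] -/
theorem hzCylShifts_far (ℓ : ℕ) (U : Set (hzCyl ℓ)) (hU : U.Finite) :
    ∃ γ ∈ hzCylShifts ℓ, Disjoint ((γ : hzCyl ℓ → hzCyl ℓ) '' U) U := by
  classical
  set M : ℤ := ∑ v ∈ hU.toFinset, |((v : hzCyl ℓ) : HZ) 3| with hM
  have hbd : ∀ v ∈ U, |((v : hzCyl ℓ) : HZ) 3| ≤ M := fun v hv =>
    Finset.single_le_sum (f := fun v : hzCyl ℓ => |((v : hzCyl ℓ) : HZ) 3|) (fun _ _ => abs_nonneg _)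
      (hU.mem_toFinset.2 hv)
  have hM0 : 0 ≤ M := Finset.sum_nonneg fun _ _ => abs_nonneg _
  refine ⟨hzCylShift ℓ 0 (2 * M + 1), ⟨(0, 2 * M + 1), rfl⟩, Set.disjoint_left.2 ?_⟩
  rintro w ⟨u, hu, rfl⟩ hγu
  have h1 := hbd u hu
  have h2 := hbd _ hγu
  rw [hzCylShift_apply_val, (hzMul_central_apply 0 (2 * M + 1) (u : HZ)).2.2.2] at h2
  rw [abs_le] at h1 h2
  linarith [h1.1, h2.2]

/-- An ambient automorphism preserving the cylinder preserves its boundary. [folklore] -/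
theorem mem_tubeBoundary_hzCylShift_iff (ℓ : ℕ) (c t : ℤ) (v : hzCyl ℓ) :
    hzCylShift ℓ c t v ∈ tubeBoundary heisenbergZGraph (hzCyl ℓ) ↔ v ∈ tubeBoundary heisenbergZGraph (hzCyl ℓ) := by
  simp only [mem_tubeBoundary, hzCylShift_apply_val]
  constructor
  · rintro ⟨u, huT, hadj⟩
    refine ⟨hzMul ![0, 0, -c, -t] u, fun h => huT ?_, ?_⟩
    · have := (hzMul_central_mem_hzCyl (ℓ := ℓ) c t).2 h
      rw [← hzMul_assoc] at this
      have e : hzMul ![0, 0, c, t] ![0, 0, -c, -t] = (0 : HZ) := by ext i; fin_cases i <;> simp [hzMul]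
      rwa [e, zero_hzMul] at this
    · have h := (hzLeftIso ![0, 0, -c, -t]).map_adj_iff.2 hadj
      rw [hzLeftIso_apply, hzLeftIso_apply, ← hzMul_assoc] at h
      have e : hzMul ![0, 0, -c, -t] ![0, 0, c, t] = (0 : HZ) := by ext i; fin_cases i <;> simp [hzMul]
      rwa [e, zero_hzMul] at h
  · rintro ⟨u, huT, hadj⟩
    refine ⟨hzMul ![0, 0, c, t] u, fun h => huT ((hzMul_central_mem_hzCyl (ℓ := ℓ) c t).1 h), ?_⟩
    have h := (hzLeftIso ![0, 0, c, t]).map_adj_iff.2 hadj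
    rwa [hzLeftIso_apply, hzLeftIso_apply] at h

/-- The boundary of the cylinder is non-empty: `(ℓ,0,0,0) ∼ (ℓ+1,0,0,0)`. [folklore] -/
theorem tubeBoundary_hzCyl_nonempty (ℓ : ℕ) : (tubeBoundary heisenbergZGraph (hzCyl ℓ)).Nonempty := by
  have hm : (![(ℓ : ℤ), 0, 0, 0] : HZ) ∈ hzCyl ℓ := by simp [mem_hzCyl_iff]
  refine ⟨⟨![(ℓ : ℤ), 0, 0, 0], hm⟩, (mem_tubeBoundary _ _ _).2 ⟨hzMul ![(ℓ : ℤ), 0, 0, 0] gA, ?_, ?_⟩⟩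
  · intro h
    have h0 := h.1
    simp [hzMul, gA] at h0
    rw [abs_le] at h0
    linarith [h0.2]
  · exact adj_mul_gen _ (Or.inl rfl)

/-! ## §4 The cylinder graph is quasi-transitive and amenable; uniqueness inside the cylinder -/

/-- **Quasi-transitive**: the central shifts bring every vertex to one of the `(2ℓ+1)²` representatives `(a,b,0,0)`. [folklore] -/
theorem hzCylGraph_quasiTransitive (ℓ : ℕ) : IsQuasiTransitive (hzCylGraph ℓ) := by
  classical
  set S₀ : Finset HZ := ((Finset.Icc (-(ℓ : ℤ)) ℓ) ×ˢ (Finset.Icc (-(ℓ : ℤ)) ℓ)).image fun q => ![q.1, q.2, 0, 0] with hS₀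
  refine ⟨S₀.subtype (· ∈ hzCyl ℓ), fun v => ⟨hzCylShift ℓ (-(v : HZ) 2) (-(v : HZ) 3), ?_⟩⟩
  rw [Finset.mem_subtype, hzCylShift_apply_val, hS₀, Finset.mem_image]
  obtain ⟨h0, h1, h2, h3⟩ := hzMul_central_apply (-(v : HZ) 2) (-(v : HZ) 3) (v : HZ)
  refine ⟨((v : HZ) 0, (v : HZ) 1), ?_, ?_⟩
  · have hv := v.2
    rw [mem_hzCyl_iff, abs_le, abs_le] at hv
    simp only [Finset.mem_product, Finset.mem_Icc]
    exact ⟨⟨hv.1.1, hv.1.2⟩, ⟨hv.2.1, hv.2.2⟩⟩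
  · ext i; fin_cases i
    · simp [h0]
    · simp [h1]
    · simp [h2]
    · simp [h3]

/-- Walks in an induced subgraph give ambient walks of the same length. [folklore] -/
theorem hz_exists_walk_of_induce_walk {s : Set HZ} {u v : s} (w : (heisenbergZGraph.induce s).Walk u v) :
    ∃ w' : heisenbergZGraph.Walk (u : HZ) (v : HZ), w'.length = w.length := by
  induction w with
  | nil => exact ⟨SimpleGraph.Walk.nil, rfl⟩
  | @cons a b c hab p ih =>
    obtain ⟨w', hw'⟩ := ih
    have hab' : heisenbergZGraph.Adj (a : HZ) (b : HZ) := hab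
    exact ⟨SimpleGraph.Walk.cons hab' w', by simp [hw']⟩

/-- Balls of the cylinder graph are no larger than ambient balls: `|B(x,n)| ≤ (2n+1)⁵`. [folklore] -/
theorem ballVolume_hzCylGraph_le (ℓ : ℕ) (x : hzCyl ℓ) (n : ℕ) : ballVolume (hzCylGraph ℓ) x n ≤ (2 * n + 1) ^ 5 := by
  have hsub : Subtype.val '' graphBall (hzCylGraph ℓ) x n ⊆ graphBall heisenbergZGraph (x : HZ) n := by
    rintro _ ⟨y, ⟨w, hw⟩, rfl⟩
    obtain ⟨w', hw'⟩ := hz_exists_walk_of_induce_walk w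
    exact ⟨w', by rw [hw']; exact hw⟩
  calc ballVolume (hzCylGraph ℓ) x n = (graphBall (hzCylGraph ℓ) x n).ncard := rfl
    _ = (Subtype.val '' graphBall (hzCylGraph ℓ) x n).ncard := (Set.ncard_image_of_injective _ Subtype.val_injective).symm
    _ ≤ (graphBall heisenbergZGraph (x : HZ) n).ncard := Set.ncard_le_ncard hsub (graphBall_finite heisenbergZGraph _ n)
    _ ≤ (2 * n + 1) ^ 5 := ballVolume_heisenbergZ_le _ n

/-- The cylinder graph does not have exponential growth. [folklore] -/
theorem hzCylGraph_not_hasExponentialGrowth (ℓ : ℕ) : ¬ HasExponentialGrowth (hzCylGraph ℓ) := by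
  intro h
  obtain ⟨c, hc, hev⟩ := h ⟨0, zero_mem_hzCyl ℓ⟩
  obtain ⟨n, hn1, hn2⟩ := (hev.and (eventually_pow_lt_const_pow 5 hc)).exists
  have hvol : (ballVolume (hzCylGraph ℓ) ⟨0, zero_mem_hzCyl ℓ⟩ n : ℝ) ≤ (2 * n + 1) ^ 5 := by
    exact_mod_cast ballVolume_hzCylGraph_le ℓ _ n
  linarith

/-- **The cylinder graph is amenable** (polynomial growth). [cite: LyonsPeres2016, §6.1 (p. 279)] -/
theorem hzCylGraph_amenable (ℓ : ℕ) : IsGraphAmenable (hzCylGraph ℓ) := by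
  by_contra h
  exact hzCylGraph_not_hasExponentialGrowth ℓ
    (hasExponentialGrowth_of_not_isGraphAmenable (hzCylGraph ℓ) (hzCylGraph_quasiTransitive ℓ) h)

/-- **Uniqueness INSIDE the cylinder at every density** (Burton–Keane on the connected, quasi-transitive, amenable cylinder graph).
[cite: BurtonKeane1989, Thm. 2] [cite: LyonsPeres2016, Thm. 7.6] -/
theorem hzCylGraph_numInfiniteClusters_le_one {ℓ : ℕ} (hℓ : 1 ≤ ℓ) (p : unitInterval) :
    ∀ᵐ ω ∂(bondPercolation (hzCylGraph ℓ) p), numInfiniteClusters ω ≤ 1 :=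
  BurtonKeane1989_atMostOneInfiniteCluster_holds (hzCylGraph ℓ) (hzCylGraph_connected hℓ) (hzCylGraph_quasiTransitive ℓ)
    (hzCylGraph_amenable ℓ) p

/-! ## §5 Free side-steering inside the cylinder -/

/-- **(F2) for `H₃(ℤ) × ℤ`: same-`p` steering toward the boundary of every cylinder is free.**  For `p > 0`, `ℓ ≥ 1` and
`x ∈ hzCyl ℓ`: `θ_{H₃×ℤ}(x, p) ≤ P_p(x is joined by an open path INSIDE hzCyl ℓ to a vertex of hzCyl ℓ having a neighbour outside it)`.
In particular at `p = p_c(H₃×ℤ)` with `θ > 0` this is the Lemma-9-type input of the skeleton re-typing toward the planar faces, with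
no subcriticality hypothesis; the residue `HeisenbergZCylSubcritical` concerns the fibre extent of such connections, not their
existence. [cite: LyonsPeres2016, Thm. 7.5 and Thm. 7.6] [cite: KozmaNitzan2024, §4 Lemma 9 (p. 16)] -/
theorem hz_theta_le_prob_reach_cylBoundary {ℓ : ℕ} (hℓ : 1 ≤ ℓ) {p : unitInterval} (hp : 0 < (p : ℝ))
    (x : HZ) (hx : x ∈ hzCyl ℓ) :
    theta heisenbergZGraph x p ≤ (bondPercolation heisenbergZGraph p).real
      {ω | ∃ a : hzCyl ℓ, a ∈ tubeBoundary heisenbergZGraph (hzCyl ℓ) ∧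
        (openGraph (restrictConfig (Subtype.val : hzCyl ℓ → HZ) ω)).Reachable ⟨x, hx⟩ a} :=
  theta_le_prob_reach_boundary_within heisenbergZGraph (hzCyl ℓ) (hzCylGraph_connected hℓ) hp (hzCylShifts ℓ)
    (hzCylShifts_far ℓ) (tubeBoundary_hzCyl_nonempty ℓ)
    (by rintro γ ⟨⟨c, t⟩, rfl⟩ v; exact mem_tubeBoundary_hzCylShift_iff ℓ c t v)
    (hzCylGraph_numInfiniteClusters_le_one hℓ p) x hx

/-! ## §6 The rung from the DROP node (design (D) 'CONCENTRIC') -/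

/-- **`θ_{H₃(ℤ)×ℤ}(p_c) = 0` from the lane's DROP node plus the one residue** (uniqueness by Burton–Keane on the amenable Cayley graph,
cylinders at `p_c` by `HeisenbergZCylSubcritical`).  Conditional on both; neither is claimed. [cite: BenjaminiSchramm1996, Conj. 4]
[cite: KozmaNitzan2024, §1 p. 2 (approach 1)] -/
theorem heisenbergZCriticalContinuity_of_dropNode_of_cylSubcritical (hD : SamePDropOfSkeleton)
    (hC : HeisenbergZCylSubcritical) : HeisenbergZCriticalContinuity := by
  unfold HeisenbergZCriticalContinuity
  exact continuity_of_skeleton_drop_amenable hD heisenbergZGraph hzSkeleton heisenbergZGraph_connected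
    heisenbergZGraph_quasiTransitive isGraphAmenable_heisenbergZ 0 (Finset.mem_singleton_self _)
    (hzSkeleton_cylSubcritical_of hC)

end Summit.CriticalPhenomena.PercolationContinuityZ3.Theorems.Transplant

end
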